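import Summits.Ventures.QEDPrecision.Integrands.KallenSabryPhi

/-!
# (R-IBP), part 2/3: interval-integrability on `[0,1]` of `S`, of `Φ(·,x)` and continuity of the regular
factors `p, q, P, D` (venture QEDPrecision, cell `pub-qed`, integrator seat quad, gen 10)

HONEST FRAMING (verbatim, venture QEDPrecision): independent recomputation; certified where stated,
statistical where stated; no new-physics claim.

`Φ` (part 1, `phiIBP`) has integrable logarithmic singularities `ln t` at `t = 0` and `ln(1−t)` at `t = 1`
and four REMOVABLE `0/0` points — `ln(1−t)/t`, `ln(1+t)/t` at `t → 0` and `ln((1+t)/2)/(1−t)`,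
`ln(2t/(1+t))/(1−t²)` at `t → 1` (memo `certs/SetIbIc/repr/R-IBP.md`, "SINGULARITY STRUCTURE"). Here the
removable pieces are bounded by the elementary inequalities `1 − 1/u ≤ ln u ≤ u − 1` and integrated as
bounded continuous functions on open intervals; the logarithms by translation of Mathlib's
`intervalIntegrable_log'`. NO numerical value is asserted.
-/

noncomputable section

open Real Set MeasureTheory intervalIntegral

namespace Summit.Ventures.QEDPrecision.Integrands

open Literature.Analysis.SpecialFunctions (reDilog continuous_reDilog)

/-! ## Interval-integrability on `[0,1]` -/

/-- A real function continuous and bounded on `(a,b)` is interval-integrable on `[a,b]`. [folklore] -/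
theorem intervalIntegrable_of_continuousOn_Ioo_of_bound {f : ℝ → ℝ} {a b C : ℝ} (hab : a ≤ b)
    (hf : ContinuousOn f (Ioo a b)) (hC : ∀ t ∈ Ioo a b, |f t| ≤ C) :
    IntervalIntegrable f volume a b := by
  rw [intervalIntegrable_iff_integrableOn_Ioo_of_le hab]
  have hmeas : AEStronglyMeasurable f (volume.restrict (Ioo a b)) :=
    hf.aestronglyMeasurable measurableSet_Ioo
  have hg : IntegrableOn (fun _ : ℝ => C) (Ioo a b) volume :=
    integrableOn_const (hs := measure_Ioo_lt_top.ne)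
  exact Integrable.mono' hg hmeas
    (ae_restrict_of_forall_mem measurableSet_Ioo fun t ht => by
      rw [Real.norm_eq_abs]; exact hC t ht)

/-- `ln(1 − t)` is interval-integrable on every interval. [folklore] -/
theorem intervalIntegrable_log_one_sub (a b : ℝ) :
    IntervalIntegrable (fun t : ℝ => log (1 - t)) volume a b := by
  have h := (intervalIntegral.intervalIntegrable_log' (a := 1 - a) (b := 1 - b)).comp_sub_left 1
  simpa using h

/-- `ln(1 + t)` is interval-integrable on every interval. [folklore] -/
theorem intervalIntegrable_log_one_add (a b : ℝ) :
    IntervalIntegrable (fun t : ℝ => log (1 + t)) volume a b := by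
  have h := (intervalIntegral.intervalIntegrable_log' (a := a + 1) (b := b + 1)).comp_add_left 1
  simpa using h

/-- `ln((1+t)/(1−t))` is interval-integrable on `[0,1]`. [folklore] -/
theorem intervalIntegrable_log_ratio :
    IntervalIntegrable (fun t : ℝ => log ((1 + t) / (1 - t))) volume 0 1 := by
  refine ((intervalIntegrable_log_one_add 0 1).sub (intervalIntegrable_log_one_sub 0 1)).congr_uIoo ?_
  intro t ht
  rw [uIoo_of_le zero_le_one] at ht
  simp only
  rw [Real.log_div (by linarith [ht.1]) (by linarith [ht.2])]

/-- `S` is interval-integrable on `[0,1]` (integrable logarithms at `0` and `1`; the four `0/0` points are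
removable, bounded via `1 − 1/u ≤ ln u ≤ u − 1`). [folklore] -/
theorem intervalIntegrable_ksS : IntervalIntegrable ksS volume 0 1 := by
  -- s1 on [0, 1/2]: −4/(1−t²) · (ln 2 + ln t − ln(1+t))
  have hs1a : IntervalIntegrable (fun t : ℝ => -4 * log (2 * t / (1 + t)) / (1 - t ^ 2))
      volume 0 (1 / 2) := by
    have hA : IntervalIntegrable (fun t : ℝ => log 2 + log t - log (1 + t)) volume 0 (1 / 2) :=
      (intervalIntegrable_const.add intervalIntegral.intervalIntegrable_log').sub
        (intervalIntegrable_log_one_add 0 (1 / 2))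
    have hB : ContinuousOn (fun t : ℝ => -4 / (1 - t ^ 2)) (uIcc (0:ℝ) (1 / 2)) := by
      rw [uIcc_of_le (by norm_num)]
      refine ContinuousOn.div continuousOn_const (by fun_prop) ?_
      intro t ht
      nlinarith [ht.1, ht.2]
    refine (hA.continuousOn_mul hB).congr_uIoo ?_
    intro t ht
    rw [uIoo_of_le (by norm_num)] at ht
    have ht0 : 0 < t := ht.1
    simp only
    rw [Real.log_div (by positivity) (by linarith), Real.log_mul two_ne_zero ht0.ne']
    ring
  -- s1 on [1/2, 1]: continuous on the open interval and bounded by 4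
  have hs1b : IntervalIntegrable (fun t : ℝ => -4 * log (2 * t / (1 + t)) / (1 - t ^ 2))
      volume (1 / 2) 1 := by
    refine intervalIntegrable_of_continuousOn_Ioo_of_bound (C := 4) (by norm_num) ?_ ?_
    · refine ContinuousOn.div (continuousOn_const.mul (ContinuousOn.log ?_ ?_)) (by fun_prop) ?_
      · exact ContinuousOn.div (by fun_prop) (by fun_prop) fun t ht => by
          have : (0:ℝ) < 1 + t := by linarith [ht.1]
          exact this.ne'
      · intro t ht
        have h1 : (0:ℝ) < t := by linarith [ht.1]
        have h2 : (0:ℝ) < 1 + t := by linarith [ht.1]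
        exact (div_pos (by positivity) h2).ne'
      · intro t ht
        nlinarith [ht.1, ht.2]
    · intro t ht
      obtain ⟨ht0, ht1⟩ := ht
      have htp : 0 < t := by linarith
      have h1p : 0 < 1 + t := by linarith
      have hu0 : 0 < 2 * t / (1 + t) := by positivity
      have hu1 : 2 * t / (1 + t) ≤ 1 := by
        rw [div_le_one h1p]; linarith
      have hlog0 : log (2 * t / (1 + t)) ≤ 0 := Real.log_nonpos hu0.le hu1
      have hlog1 : 1 - (2 * t / (1 + t))⁻¹ ≤ log (2 * t / (1 + t)) :=
        Real.one_sub_inv_le_log_of_pos hu0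
      rw [inv_div] at hlog1
      have h1t2 : 0 < 1 - t ^ 2 := by nlinarith
      have key : -log (2 * t / (1 + t)) ≤ 1 - t ^ 2 := by
        have hB : 1 ≤ 2 * t * (1 + t) := by nlinarith
        have : (1 + t) / (2 * t) - 1 ≤ 1 - t ^ 2 := by
          rw [div_sub_one (by positivity), div_le_iff₀ (by positivity)]
          nlinarith [mul_nonneg (sub_nonneg.2 ht1.le) (sub_nonneg.2 hB)]
        linarith
      rw [abs_div, abs_mul, abs_of_pos h1t2, abs_of_nonpos hlog0, div_le_iff₀ h1t2]
      norm_num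
      linarith
  -- s2 on [0,1]: (2/(1+t)) · (ln(1−t) − ln 2)
  have hs2 : IntervalIntegrable (fun t : ℝ => 2 * log ((1 - t) / 2) / (1 + t)) volume 0 1 := by
    have hA : IntervalIntegrable (fun t : ℝ => log (1 - t) - log 2) volume 0 1 :=
      (intervalIntegrable_log_one_sub 0 1).sub intervalIntegrable_const
    have hB : ContinuousOn (fun t : ℝ => 2 / (1 + t)) (uIcc (0:ℝ) 1) := by
      rw [uIcc_of_le zero_le_one]
      refine ContinuousOn.div continuousOn_const (by fun_prop) ?_
      intro t ht
      have : (0:ℝ) < 1 + t := by linarith [ht.1]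
      exact this.ne'
    refine (hA.continuousOn_mul hB).congr_uIoo ?_
    intro t ht
    rw [uIoo_of_le zero_le_one] at ht
    simp only
    rw [Real.log_div (by linarith [ht.2]) two_ne_zero]
    ring
  -- s3 on [0,1]: continuous on (0,1), bounded by 2
  have hs3 : IntervalIntegrable (fun t : ℝ => 2 * log ((1 + t) / 2) / (1 - t)) volume 0 1 := by
    refine intervalIntegrable_of_continuousOn_Ioo_of_bound (C := 2) zero_le_one ?_ ?_
    · refine ContinuousOn.div (continuousOn_const.mul (ContinuousOn.log (by fun_prop) ?_))
        (by fun_prop) ?_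
      · intro t ht
        have : (0:ℝ) < 1 + t := by linarith [ht.1]
        exact (div_pos this two_pos).ne'
      · intro t ht
        have : (0:ℝ) < 1 - t := by linarith [ht.2]
        exact this.ne'
    · intro t ht
      obtain ⟨ht0, ht1⟩ := ht
      have h1p : 0 < 1 + t := by linarith
      have h1m : 0 < 1 - t := by linarith
      have hu0 : 0 < (1 + t) / 2 := div_pos h1p two_pos
      have hu1 : (1 + t) / 2 ≤ 1 := by linarith
      have hlog0 : log ((1 + t) / 2) ≤ 0 := Real.log_nonpos hu0.le hu1
      have hlog1 : 1 - ((1 + t) / 2)⁻¹ ≤ log ((1 + t) / 2) := Real.one_sub_inv_le_log_of_pos hu0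
      rw [inv_div] at hlog1
      have key : -log ((1 + t) / 2) ≤ 1 - t := by
        have : 2 / (1 + t) - 1 ≤ 1 - t := by
          rw [div_sub_one h1p.ne', div_le_iff₀ h1p]
          nlinarith [mul_nonneg ht0.le h1m.le]
        linarith
      rw [abs_div, abs_mul, abs_of_pos h1m, abs_of_nonpos hlog0, div_le_iff₀ h1m]
      norm_num
      linarith
  -- s4 on [0, 1/2]: continuous on (0,1/2), bounded by 4
  have hs4a : IntervalIntegrable (fun t : ℝ => 2 * log (1 - t) / t) volume 0 (1 / 2) := by
    refine intervalIntegrable_of_continuousOn_Ioo_of_bound (C := 4) (by norm_num) ?_ ?_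
    · refine ContinuousOn.div (continuousOn_const.mul (ContinuousOn.log (by fun_prop) ?_))
        (by fun_prop) ?_
      · intro t ht
        have : (0:ℝ) < 1 - t := by linarith [ht.2]
        exact this.ne'
      · intro t ht
        exact (ht.1 : (0:ℝ) < t).ne'
    · intro t ht
      obtain ⟨ht0, ht1⟩ := ht
      have h1m : 0 < 1 - t := by linarith
      have hlog0 : log (1 - t) ≤ 0 := Real.log_nonpos h1m.le (by linarith)
      have hlog1 : 1 - (1 - t)⁻¹ ≤ log (1 - t) := Real.one_sub_inv_le_log_of_pos h1m
      have key : -log (1 - t) ≤ 2 * t := by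
        have : (1 - t)⁻¹ - 1 ≤ 2 * t := by
          rw [inv_eq_one_div, div_sub_one h1m.ne', div_le_iff₀ h1m]
          nlinarith [mul_nonneg ht0.le (sub_nonneg.2 (by linarith : 2 * t ≤ 1))]
        linarith
      rw [abs_div, abs_mul, abs_of_pos ht0, abs_of_nonpos hlog0, div_le_iff₀ ht0]
      norm_num
      linarith
  -- s4 on [1/2, 1]: (2/t) · ln(1−t)
  have hs4b : IntervalIntegrable (fun t : ℝ => 2 * log (1 - t) / t) volume (1 / 2) 1 := by
    have hB : ContinuousOn (fun t : ℝ => 2 / t) (uIcc ((1:ℝ) / 2) 1) := by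
      rw [uIcc_of_le (by norm_num)]
      refine ContinuousOn.div continuousOn_const (by fun_prop) ?_
      intro t ht
      have : (0:ℝ) < t := by linarith [ht.1]
      exact this.ne'
    have h := (intervalIntegrable_log_one_sub (1 / 2) 1).continuousOn_mul hB
    refine h.congr_uIoo ?_
    intro t _
    simp only
    ring
  -- s5 on [0,1]: continuous on (0,1), bounded by 2
  have hs5 : IntervalIntegrable (fun t : ℝ => 2 * log (1 + t) / t) volume 0 1 := by
    refine intervalIntegrable_of_continuousOn_Ioo_of_bound (C := 2) zero_le_one ?_ ?_
    · refine ContinuousOn.div (continuousOn_const.mul (ContinuousOn.log (by fun_prop) ?_))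
        (by fun_prop) ?_
      · intro t ht
        have : (0:ℝ) < 1 + t := by linarith [ht.1]
        exact this.ne'
      · intro t ht
        exact (ht.1 : (0:ℝ) < t).ne'
    · intro t ht
      obtain ⟨ht0, ht1⟩ := ht
      have h1p : 0 < 1 + t := by linarith
      have hlog0 : 0 ≤ log (1 + t) := Real.log_nonneg (by linarith)
      have hlog1 : log (1 + t) ≤ 1 + t - 1 := Real.log_le_sub_one_of_pos h1p
      rw [abs_div, abs_mul, abs_of_pos ht0, abs_of_nonneg hlog0, div_le_iff₀ ht0]
      norm_num
      linarith
  have h := ((((hs1a.trans hs1b).add hs2).add hs3).sub (hs4a.trans hs4b)).add hs5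
  exact h

/-! ## Continuity on `[0,1]` of the regular factors -/

/-- `p(·,x)` is continuous on `[0,1]` for `0 < x < 1` (`(2−x)² − x²t² ≥ 4(1−x) > 0`). [folklore] -/
theorem continuousOn_ksP {x : ℝ} (hx0 : 0 < x) (hx1 : x < 1) :
    ContinuousOn (fun t : ℝ => ksP x t) (Icc 0 1) := by
  unfold ksP
  refine ContinuousOn.div (by fun_prop) (by fun_prop) ?_
  intro t ht
  have ht2 : t ^ 2 ≤ 1 := by nlinarith [ht.1, ht.2]
  have hx2 : 0 < x ^ 2 := by positivity
  have hxt : x ^ 2 * t ^ 2 ≤ x ^ 2 := by nlinarith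
  nlinarith

/-- `q(·,x)` is continuous on `[0,1]` for `0 < x < 1`. [folklore] -/
theorem continuousOn_ksQ {x : ℝ} (hx0 : 0 < x) (hx1 : x < 1) :
    ContinuousOn (fun t : ℝ => ksQ x t) (Icc 0 1) := by
  unfold ksQ
  exact (continuousOn_ksP hx0 hx1).mul (by fun_prop)

/-- `P(·,x)` is continuous on `[0,1]` for `0 < x < 1`. [folklore] -/
theorem continuousOn_ksPrim {x : ℝ} (hx0 : 0 < x) (hx1 : x < 1) :
    ContinuousOn (fun t : ℝ => ksPrim x t) (Icc 0 1) :=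
  HasDerivAt.continuousOn (f' := fun t => ksQ x t) fun t ht =>
    hasDerivAt_ksPrim hx0 hx1 (by linarith [ht.1]) ht.2

/-- The dilogarithm bracket `D` is continuous on `[0,1]`. [folklore] -/
theorem continuousOn_ksD : ContinuousOn (fun t : ℝ => ksD t) (Icc 0 1) := by
  have hc : Continuous reDilog := continuous_reDilog
  have h1 : ContinuousOn (fun t : ℝ => reDilog ((1 - t) / (1 + t))) (Icc 0 1) :=
    hc.comp_continuousOn (ContinuousOn.div (by fun_prop) (by fun_prop) fun t ht => by
      have : (0:ℝ) < 1 + t := by linarith [ht.1]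
      exact this.ne')
  have h2 : Continuous (fun t : ℝ => reDilog ((1 + t) / 2)) := hc.comp (by fun_prop)
  have h3 : Continuous (fun t : ℝ => reDilog ((1 - t) / 2)) := hc.comp (by fun_prop)
  have h5 : Continuous (fun t : ℝ => reDilog (t ^ 2)) := hc.comp (by fun_prop)
  unfold ksD
  exact ((((continuousOn_const.add (continuousOn_const.mul h1)).add
    (continuousOn_const.mul h2.continuousOn)).sub (continuousOn_const.mul h3.continuousOn)).sub
    (continuousOn_const.mul hc.continuousOn)).add h5.continuousOn

/-- `Φ(·,x)` is interval-integrable on `[0,1]` for `0 < x < 1`. [folklore] -/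
theorem intervalIntegrable_phiIBP {x : ℝ} (hx0 : 0 < x) (hx1 : x < 1) :
    IntervalIntegrable (fun t : ℝ => phiIBP x t) volume 0 1 := by
  have hP := continuousOn_ksP hx0 hx1
  have hQ := continuousOn_ksQ hx0 hx1
  have hPrim := continuousOn_ksPrim hx0 hx1
  have hl2 : ContinuousOn (fun t : ℝ => log ((1 + t) / 2)) (Icc 0 1) := by
    refine ContinuousOn.log (by fun_prop) ?_
    intro t ht
    have : (0:ℝ) < 1 + t := by linarith [ht.1]
    exact (div_pos this two_pos).ne'
  have hL := intervalIntegrable_log_ratio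
  -- term 1: (q · ln((1+t)/2)) · L
  have h1 : IntervalIntegrable (fun t : ℝ => ksQ x t * log ((1 + t) / 2) * log ((1 + t) / (1 - t)))
      volume 0 1 := by
    refine hL.continuousOn_mul ?_
    rw [uIcc_of_le zero_le_one]
    exact hQ.mul hl2
  -- term 2: p · (T₂ L + T₃ + T₄)
  have hT3 : IntervalIntegrable (fun t : ℝ => ksT3 t) volume 0 1 := by
    have hA : IntervalIntegrable (fun t : ℝ => 3 * log ((1 + t) / 2) - 2 * log t) volume 0 1 := by
      refine IntervalIntegrable.sub ?_ (intervalIntegral.intervalIntegrable_log'.const_mul 2)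
      refine ContinuousOn.intervalIntegrable ?_
      rw [uIcc_of_le zero_le_one]
      exact continuousOn_const.mul hl2
    have hB : ContinuousOn (fun t : ℝ => t * (3 - t ^ 2)) (uIcc (0:ℝ) 1) := by fun_prop
    unfold ksT3
    exact hA.continuousOn_mul hB
  have h2 : IntervalIntegrable
      (fun t : ℝ => ksP x t * (ksT2 t * log ((1 + t) / (1 - t)) + ksT3 t + ksT4 t)) volume 0 1 := by
    have hT2L : IntervalIntegrable (fun t : ℝ => ksT2 t * log ((1 + t) / (1 - t))) volume 0 1 := by
      refine hL.continuousOn_mul ?_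
      unfold ksT2; fun_prop
    have hT4 : IntervalIntegrable (fun t : ℝ => ksT4 t) volume 0 1 := by
      refine ContinuousOn.intervalIntegrable ?_
      unfold ksT4; fun_prop
    refine ((hT2L.add hT3).add hT4).continuousOn_mul ?_
    rw [uIcc_of_le zero_le_one]
    exact hP
  -- term 3: P · S
  have h3 : IntervalIntegrable (fun t : ℝ => ksPrim x t * ksS t) volume 0 1 := by
    refine intervalIntegrable_ksS.continuousOn_mul ?_
    rw [uIcc_of_le zero_le_one]
    exact hPrim
  have h := (h1.add h2).add h3
  unfold phiIBP
  exact h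

end Summit.Ventures.QEDPrecision.Integrands

end
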